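import Summits.CriticalPhenomena.Ising3D.TaylorTableOddHeadTerm2
import Summits.CriticalPhenomena.Ising3D.TaylorTableOddHeadDeltaMergedCells
import HarnessLib

/-!
# XXXIe: `parts2_sound`, `final2_sound`, group parts, `table_data2`, the CELL THEOREM `oddHead_nonneg_of_parts2`
(cell `pub-ising3x`, seat boot-1 gen 15/16; the MERGED-2 (first-order) odd-head test chain, landed per LEAN-PLAN-MERGED2 in ten modules)

HONEST FRAMING: lottery ticket; floor = tightest certified 3D Ising CFT bounds; no exact-solution
claim without a proof. Island framing: certified exclusion region at stated derivative order and
assumptions; not a determination of the 3D Ising critical exponents beyond that.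

Drafted and kernel-checked as one combined file (oddtest2/lean-draft/Merged2CellCombined.lean, 83 theorems, standard axioms); landed in slices of ≤ 400 lines. [folklore]
-/

namespace Summit.CriticalPhenomena.Ising3D

open Finset Set
open Literature.Analysis.ValidatedNumerics Literature.Analysis.ValidatedNumerics.PolyMP
open Literature.Analysis.ValidatedNumerics.NumericsMP
open Literature.MathematicalPhysics.QuantumFieldTheory.ConformalBootstrap3D
open Literature.MathematicalPhysics.QuantumFieldTheory.ConformalBootstrap3D.HRTM
open Literature.MathematicalPhysics.QuantumFieldTheory.ConformalBootstrap3D.PointKernel (mulQ mem_mulQ legendreLamQ)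

namespace HeadParts2

open HRTMAB2 (T3 rowEntry2)

/-- `(l.drop m).drop n = l.drop (m + n)` (stated in the orientation used below). [folklore] -/
theorem drop_drop' {α : Type*} : ∀ (l : List α) (m n : ℕ), (l.drop m).drop n = l.drop (m + n)
  | l, 0, n => by simp
  | [], m + 1, n => by simp
  | a :: l, m + 1, n => by
      simp only [List.drop_succ_cons, Nat.succ_add]; exact drop_drop' l m n

/-- `l.take (m + n) = l.take m ++ (l.drop m).take n`. [folklore] -/
theorem take_add' {α : Type*} : ∀ (l : List α) (m n : ℕ), l.take (m + n) = l.take m ++ (l.drop m).take n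
  | [], m, n => by simp
  | l, 0, n => by simp
  | a :: l, m + 1, n => by
      simp only [List.take_succ_cons, List.drop_succ_cons, Nat.succ_add, List.cons_append]
      rw [take_add' l m n]

/-- **Soundness of the parts layer**: parts chained from `pos`, each passing `oddPartOK2`, give member lists of the summed
claims `sum4 ps` whose value identity covers the head terms `(C.F.drop pos).take (countSum2 ps)`. [folklore] -/
theorem parts2_sound {R : OddHeadRowsΔ} (hS : 0 < R.S) {C : EvenCellTM} {TS TP TM : List (List HRTMAB2.TPoly)} {sc : Scal2}
    {Wn : ℤ} {Wd : ℕ}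
    {r3 r4 r5 r0 rt : ℕ → List ℝ × List ℝ × List ℝ}
    (h3 : ∀ q ∈ C.F, PMem3 R.S (r3 q.2) (R.lit q.2).1) (h4 : ∀ q ∈ C.F, PMem3 R.S (r4 q.2) (R.lit q.2).2.1)
    (h5 : ∀ q ∈ C.F, PMem3 R.S (r5 q.2) (R.lit q.2).2.2.1) (h0 : ∀ q ∈ C.F, PMem3 R.S (r0 q.2) (R.lit q.2).2.2.2.1)
    (ht : ∀ q ∈ C.F, PMem3 R.S (rt q.2) (R.lit q.2).2.2.2.2)
    {x y : ℝ} (hx : |x| ≤ R.Wσ) (hy : |y| ≤ R.Wε)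
    {eS0 eS1 eS2 eP0 eP1 eP2 eM0 eM1 eM2 : ℕ × ℕ → List ℝ}
    (mS0 : ∀ q ∈ C.F, PMem R.S (eS0 q) (t3split Wn Wd (rowEntry2 TS C.nF q.1 q.2)).1)
    (mS1 : ∀ q ∈ C.F, PMem R.S (eS1 q) (t3split Wn Wd (rowEntry2 TS C.nF q.1 q.2)).2.1)
    (mS2 : ∀ q ∈ C.F, PMem R.S ((eS2 q).map fun c => |c| * (x - y) ^ 2) (t3split Wn Wd (rowEntry2 TS C.nF q.1 q.2)).2.2)
    (mP0 : ∀ q ∈ C.F, PMem R.S (eP0 q) (t3split Wn Wd (rowEntry2 TP C.nF q.1 q.2)).1)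
    (mP1 : ∀ q ∈ C.F, PMem R.S (eP1 q) (t3split Wn Wd (rowEntry2 TP C.nF q.1 q.2)).2.1)
    (mP2 : ∀ q ∈ C.F, PMem R.S ((eP2 q).map fun c => |c| * (x - y) ^ 2) (t3split Wn Wd (rowEntry2 TP C.nF q.1 q.2)).2.2)
    (mM0 : ∀ q ∈ C.F, PMem R.S (eM0 q) (t3split Wn Wd (rowEntry2 TM C.nF q.1 q.2)).1)
    (mM1 : ∀ q ∈ C.F, PMem R.S (eM1 q) (t3split Wn Wd (rowEntry2 TM C.nF q.1 q.2)).2.1)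
    (mM2 : ∀ q ∈ C.F, PMem R.S ((eM2 q).map fun c => |c| * (x - y) ^ 2) (t3split Wn Wd (rowEntry2 TM C.nF q.1 q.2)).2.2)
    {κc C0c Ctc : ℝ} (hK : MI.mem R.S κc sc.K) (hdK : MI.mem R.S (Real.log 2 * κc) sc.dK)
    (hC0 : MI.mem R.S C0c sc.C0) (hdC0 : MI.mem R.S (2 * Real.log 2 * C0c) sc.dC0x)
    (hCt : MI.mem R.S Ctc sc.Ct) (hdCt : MI.mem R.S (2 * Real.log 2 * Ctc) sc.dCty)
    {W : ℝ} (hWs : (R.Wσ : ℝ) ≤ W) (hWe : (R.Wε : ℝ) ≤ W) (hU : 2 * W * Real.log 2 ≤ sc.U) (hU1 : (sc.U : ℝ) ≤ 1)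
    (ρ : ℝ) :
    ∀ (ps : List HeadPart2) (pos : ℕ), chainFrom2 pos ps = true →
      (∀ p ∈ ps, oddPartOK2 R C TS TP TM sc Wn Wd p = true) →
      ∃ b0s bxs bys rs : List ℝ,
        PMem R.S b0s (sum4 ps).1 ∧ PMem R.S bxs (sum4 ps).2.1 ∧ PMem R.S bys (sum4 ps).2.2.1 ∧
        PMem R.S rs (sum4 ps).2.2.2 ∧ (∀ r ∈ rs, 0 ≤ r) ∧
        |(((C.F.drop pos).take (countSum2 ps)).map fun q => termVal2 C.ℓ C.ctr q (r3 q.2) (r4 q.2) (r5 q.2) (r0 q.2) (rt q.2)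
            (eS0 q) (eS1 q) (eS2 q) (eP0 q) (eP1 q) (eP2 q) (eM0 q) (eM1 q) (eM2 q) κc C0c Ctc x y ρ).sum
          - (evalR b0s ρ + x * evalR bxs ρ + y * evalR bys ρ)| ≤ remAbsR rs |ρ|
  | [], pos, _, _ => ⟨[], [], [], [], by simp [sum4, pmem_nil], by simp [sum4, pmem_nil], by simp [sum4, pmem_nil],
      by simp [sum4, pmem_nil], by simp, by simp [countSum2, remAbsR]⟩
  | p :: ps, pos, hch, hparts => by
      simp only [chainFrom2, Bool.and_eq_true, decide_eq_true_eq] at hch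
      obtain ⟨ht0, hch'⟩ := hch
      have hp := hparts p (by simp)
      simp only [oddPartOK2, Bool.and_eq_true] at hp
      obtain ⟨⟨⟨s0, sx⟩, sy⟩, sr⟩ := hp
      obtain ⟨b0', bx', by', rs', p0', px', py', pr', nn', bd'⟩ :=
        parts2_sound hS h3 h4 h5 h0 ht hx hy mS0 mS1 mS2 mP0 mP1 mP2 mM0 mM1 mM2 hK hdK hC0 hdC0 hCt hdCt hWs hWe hU hU1 ρ
          ps (pos + p.count) hch' (fun p' hp' => hparts p' (List.mem_cons_of_mem _ hp'))
      have hsl : ∀ q ∈ (C.F.drop p.t0).take p.count, q ∈ C.F := fun q hq =>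
        List.mem_of_mem_drop (List.mem_of_mem_take hq)
      obtain ⟨b0, bx, by_, rs, p0, px, py, pr, nn, bd⟩ :=
        slice2_sound hS h3 h4 h5 h0 ht hx hy mS0 mS1 mS2 mP0 mP1 mP2 mM0 mM1 mM2 hK hdK hC0 hdC0 hCt hdCt hWs hWe hU hU1 ρ
          ((C.F.drop p.t0).take p.count) hsl
      refine ⟨addR b0 b0', addR bx bx', addR by_ by', addR rs rs', ?_, ?_, ?_, ?_, addR_nonneg nn nn', ?_⟩
      · simp only [sum4]; exact pmem_addI (pmem_of_subsetI p0 s0) p0'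
      · simp only [sum4]; exact pmem_addI (pmem_of_subsetI px sx) px'
      · simp only [sum4]; exact pmem_addI (pmem_of_subsetI py sy) py'
      · simp only [sum4]; exact pmem_addI (pmem_of_subsetI pr sr) pr'
      · rw [remAbsR_eq_evalR] at bd bd' ⊢
        have hsplit : (C.F.drop pos).take (countSum2 (p :: ps)) =
            (C.F.drop p.t0).take p.count ++ (C.F.drop (pos + p.count)).take (countSum2 ps) := by
          rw [countSum2, take_add', drop_drop', ht0]
        rw [hsplit, List.map_append, List.sum_append]
        simp only [evalR_addR]
        have e : ∀ (t s B Bx By B' Bx' By' : ℝ),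
            t + s - (B + B' + x * (Bx + Bx') + y * (By + By')) = (t - (B + x * Bx + y * By)) + (s - (B' + x * Bx' + y * By')) :=
          fun _ _ _ _ _ _ _ _ => by ring
        rw [e]
        exact le_trans (abs_add_le _ _) (add_le_add bd bd')

/-- **Soundness of the merged-2 final check** (the cell-level statement short of the table/literal semantics): if every part passes
`oddPartOK2`, the parts chain from 0 and tile `C.F`, and the bisected merged-2 sign test passes on the summed claims, then at every box
point `(x, y)` (`|x| ≤ Wσ`, `|y| ≤ Wε`) and every `ρ ∈ [−hw, hw]` the sum of the head-term values `Σ_{q ∈ C.F} termVal2 q` is POSITIVE.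
[folklore] -/
theorem final2_sound {R : OddHeadRowsΔ} (hS : 0 < R.S) {C : EvenCellTM} {TS TP TM : List (List HRTMAB2.TPoly)} {sc : Scal2}
    {Wn : ℤ} {Wd : ℕ}
    {r3 r4 r5 r0 rt : ℕ → List ℝ × List ℝ × List ℝ}
    (h3 : ∀ q ∈ C.F, PMem3 R.S (r3 q.2) (R.lit q.2).1) (h4 : ∀ q ∈ C.F, PMem3 R.S (r4 q.2) (R.lit q.2).2.1)
    (h5 : ∀ q ∈ C.F, PMem3 R.S (r5 q.2) (R.lit q.2).2.2.1) (h0 : ∀ q ∈ C.F, PMem3 R.S (r0 q.2) (R.lit q.2).2.2.2.1)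
    (ht : ∀ q ∈ C.F, PMem3 R.S (rt q.2) (R.lit q.2).2.2.2.2)
    {x y : ℝ} (hx : |x| ≤ R.Wσ) (hy : |y| ≤ R.Wε)
    {eS0 eS1 eS2 eP0 eP1 eP2 eM0 eM1 eM2 : ℕ × ℕ → List ℝ}
    (mS0 : ∀ q ∈ C.F, PMem R.S (eS0 q) (t3split Wn Wd (rowEntry2 TS C.nF q.1 q.2)).1)
    (mS1 : ∀ q ∈ C.F, PMem R.S (eS1 q) (t3split Wn Wd (rowEntry2 TS C.nF q.1 q.2)).2.1)
    (mS2 : ∀ q ∈ C.F, PMem R.S ((eS2 q).map fun c => |c| * (x - y) ^ 2) (t3split Wn Wd (rowEntry2 TS C.nF q.1 q.2)).2.2)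
    (mP0 : ∀ q ∈ C.F, PMem R.S (eP0 q) (t3split Wn Wd (rowEntry2 TP C.nF q.1 q.2)).1)
    (mP1 : ∀ q ∈ C.F, PMem R.S (eP1 q) (t3split Wn Wd (rowEntry2 TP C.nF q.1 q.2)).2.1)
    (mP2 : ∀ q ∈ C.F, PMem R.S ((eP2 q).map fun c => |c| * (x - y) ^ 2) (t3split Wn Wd (rowEntry2 TP C.nF q.1 q.2)).2.2)
    (mM0 : ∀ q ∈ C.F, PMem R.S (eM0 q) (t3split Wn Wd (rowEntry2 TM C.nF q.1 q.2)).1)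
    (mM1 : ∀ q ∈ C.F, PMem R.S (eM1 q) (t3split Wn Wd (rowEntry2 TM C.nF q.1 q.2)).2.1)
    (mM2 : ∀ q ∈ C.F, PMem R.S ((eM2 q).map fun c => |c| * (x - y) ^ 2) (t3split Wn Wd (rowEntry2 TM C.nF q.1 q.2)).2.2)
    {κc C0c Ctc : ℝ} (hK : MI.mem R.S κc sc.K) (hdK : MI.mem R.S (Real.log 2 * κc) sc.dK)
    (hC0 : MI.mem R.S C0c sc.C0) (hdC0 : MI.mem R.S (2 * Real.log 2 * C0c) sc.dC0x)
    (hCt : MI.mem R.S Ctc sc.Ct) (hdCt : MI.mem R.S (2 * Real.log 2 * Ctc) sc.dCty)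
    {W : ℝ} (hWs : (R.Wσ : ℝ) ≤ W) (hWe : (R.Wε : ℝ) ≤ W) (hU : 2 * W * Real.log 2 ≤ sc.U) (hU1 : (sc.U : ℝ) ≤ 1)
    {ps : List HeadPart2} {dP : ℕ} (hparts : ∀ p ∈ ps, oddPartOK2 R C TS TP TM sc Wn Wd p = true)
    (hch : chainFrom2 0 ps = true) (hcount : countSum2 ps = C.F.length)
    (hpos : posOnOddM2 R.S (sum4 ps).1 (sum4 ps).2.1 (sum4 ps).2.2.1 (sum4 ps).2.2.2 R.Wσ R.Wε dP (-C.hw) C.hw = true)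
    {ρ : ℝ} (hρ1 : ((-C.hw : ℚ) : ℝ) ≤ ρ) (hρ2 : ρ ≤ ((C.hw : ℚ) : ℝ)) :
    0 < (C.F.map fun q => termVal2 C.ℓ C.ctr q (r3 q.2) (r4 q.2) (r5 q.2) (r0 q.2) (rt q.2)
      (eS0 q) (eS1 q) (eS2 q) (eP0 q) (eP1 q) (eP2 q) (eM0 q) (eM1 q) (eM2 q) κc C0c Ctc x y ρ).sum := by
  obtain ⟨b0s, bxs, bys, rs, p0, px, py, pr, nn, bd⟩ :=
    parts2_sound hS h3 h4 h5 h0 ht hx hy mS0 mS1 mS2 mP0 mP1 mP2 mM0 mM1 mM2 hK hdK hC0 hdC0 hCt hdCt hWs hWe hU hU1 ρ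
      ps 0 hch hparts
  rw [List.drop_zero, hcount, List.take_length] at bd
  exact posOnOddM2_sound hS hx hy p0 px py pr nn (by ring) bd hpos hρ1 hρ2

/-! ### Group parts (two-level part files, as HeadPartsL): a group part passes `oddPartOK2` by PROOF from its members -/

/-- `slice2` is additive over concatenation of slices. [folklore] -/
theorem slice2_append (R : OddHeadRowsΔ) (C : EvenCellTM) (TS TP TM : List (List HRTMAB2.TPoly)) (sc : Scal2) (Wn : ℤ) (Wd : ℕ) :
    ∀ A B : List (ℕ × ℕ), slice2 R C TS TP TM sc Wn Wd (A ++ B) =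
      (addI (slice2 R C TS TP TM sc Wn Wd A).1 (slice2 R C TS TP TM sc Wn Wd B).1,
       addI (slice2 R C TS TP TM sc Wn Wd A).2.1 (slice2 R C TS TP TM sc Wn Wd B).2.1,
       addI (slice2 R C TS TP TM sc Wn Wd A).2.2.1 (slice2 R C TS TP TM sc Wn Wd B).2.2.1,
       addI (slice2 R C TS TP TM sc Wn Wd A).2.2.2 (slice2 R C TS TP TM sc Wn Wd B).2.2.2)
  | [], B => by simp [slice2, addI]
  | q :: A, B => by
      simp only [List.cons_append, slice2, slice2_append R C TS TP TM sc Wn Wd A B, addI_assoc]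

/-- The computed polynomials of a chain of passing parts are contained in their summed claims. [folklore] -/
theorem computed2_subset_sum4_of_chain (R : OddHeadRowsΔ) (C : EvenCellTM) (TS TP TM : List (List HRTMAB2.TPoly)) (sc : Scal2)
    (Wn : ℤ) (Wd : ℕ) :
    ∀ (ps : List HeadPart2) (pos : ℕ), (∀ p ∈ ps, oddPartOK2 R C TS TP TM sc Wn Wd p = true) → chainFrom2 pos ps = true →
      subsetI (slice2 R C TS TP TM sc Wn Wd (sliceOf C.F pos (countSum2 ps))).1 (sum4 ps).1 = true ∧
      subsetI (slice2 R C TS TP TM sc Wn Wd (sliceOf C.F pos (countSum2 ps))).2.1 (sum4 ps).2.1 = true ∧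
      subsetI (slice2 R C TS TP TM sc Wn Wd (sliceOf C.F pos (countSum2 ps))).2.2.1 (sum4 ps).2.2.1 = true ∧
      subsetI (slice2 R C TS TP TM sc Wn Wd (sliceOf C.F pos (countSum2 ps))).2.2.2 (sum4 ps).2.2.2 = true
  | [], pos, _, _ => by simp [slice2, sum4, countSum2, sliceOf, subsetI]
  | p :: ps, pos, hok, hch => by
      simp only [chainFrom2, Bool.and_eq_true, decide_eq_true_eq] at hch
      obtain ⟨ht0, hch'⟩ := hch
      obtain ⟨i0, ix, iy, ir⟩ :=
        computed2_subset_sum4_of_chain R C TS TP TM sc Wn Wd ps (pos + p.count)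
          (fun q hq => hok q (List.mem_cons_of_mem _ hq)) hch'
      have hp := hok p List.mem_cons_self
      simp only [oddPartOK2, Bool.and_eq_true] at hp
      obtain ⟨⟨⟨h0, hx⟩, hy⟩, hr⟩ := hp
      rw [ht0] at h0 hx hy hr
      have hs : sliceOf C.F pos (countSum2 (p :: ps)) = sliceOf C.F pos p.count ++ sliceOf C.F (pos + p.count) (countSum2 ps) := by
        simp only [countSum2, sliceOf_add]
      rw [hs, slice2_append]
      simp only [sum4]
      exact ⟨subsetI_addI h0 i0, subsetI_addI hx ix, subsetI_addI hy iy, subsetI_addI hr ir⟩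

/-- **GROUP PART THEOREM, merged-2**: a part `g` tiled by a chain of parts that each pass `oddPartOK2`, whose claims contain the
chain's summed claims, passes `oddPartOK2` — proved, not evaluated. [folklore] -/
theorem oddPartOK2_of_group {R : OddHeadRowsΔ} {C : EvenCellTM} {TS TP TM : List (List HRTMAB2.TPoly)} {sc : Scal2} {Wn : ℤ} {Wd : ℕ}
    {g : HeadPart2} {ps : List HeadPart2} (htile : groupTiles2 g ps = true)
    (hparts : ∀ p ∈ ps, oddPartOK2 R C TS TP TM sc Wn Wd p = true) (hclaims : groupClaimsOK2 g ps = true) :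
    oddPartOK2 R C TS TP TM sc Wn Wd g = true := by
  simp only [groupTiles2, Bool.and_eq_true, decide_eq_true_eq] at htile
  obtain ⟨hch, hcnt⟩ := htile
  have h := computed2_subset_sum4_of_chain R C TS TP TM sc Wn Wd ps g.t0 hparts hch
  rw [hcnt] at h
  simp only [groupClaimsOK2, Bool.and_eq_true] at hclaims
  obtain ⟨⟨⟨g0, gx⟩, gy⟩, gr⟩ := hclaims
  simp only [oddPartOK2, Bool.and_eq_true]
  exact ⟨⟨⟨subsetI_trans h.1 g0, subsetI_trans h.2.1 gx⟩, subsetI_trans h.2.2.1 gy⟩, subsetI_trans h.2.2.2 gr⟩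




/-- Table data at one `(ρ, τ)`: real `τ⁰/τ¹` lists and the `τ²` list of every entry `(n, j)`, `n ≤ nF`, of a `rows2` table, as members of
the `t3split` columns, with the evaluation identity (from `tmem_rows2`, `tpmem_split`, `pmem_t3bound`). [folklore] -/
theorem table_data2 {S : ℕ} (hS : 0 < S) {Wn : ℤ} {Wd : ℕ} (hWd : 0 < Wd) {A : ℚ} {ℓ e D nF : ℕ} (hD : 2 ≤ D)
    (hpiv : pivOK A ℓ e nF = true) (a0 a1 b0 b1 : ℚ) {ρ : ℝ} (hρ : |ρ| ≤ (((1 : ℚ) / 2 ^ e : ℚ) : ℝ)) {τ : ℝ}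
    (hτ : |τ| ≤ (Wn : ℝ) / Wd) {F : List (ℕ × ℕ)} (hF : ∀ q ∈ F, q.1 ≤ nF) :
    ∃ f : ℕ × ℕ → List ℝ × List ℝ × List ℝ, ∀ q ∈ F,
      PMem S (f q).1 (t3split Wn Wd (rowEntry2 (HRTMAB2.rows2 S A ℓ e D Wn Wd a0 a1 b0 b1 nF) nF q.1 q.2)).1 ∧
      PMem S (f q).2.1 (t3split Wn Wd (rowEntry2 (HRTMAB2.rows2 S A ℓ e D Wn Wd a0 a1 b0 b1 nF) nF q.1 q.2)).2.1 ∧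
      PMem S ((f q).2.2.map fun c => |c| * τ ^ 2)
        (t3split Wn Wd (rowEntry2 (HRTMAB2.rows2 S A ℓ e D Wn Wd a0 a1 b0 b1 nF) nF q.1 q.2)).2.2 ∧
      regAB ((a0 : ℝ) + (a1 : ℝ) * τ) ((b0 : ℝ) + (b1 : ℝ) * τ) ((A : ℝ) + ρ) ℓ q.1 q.2 =
        evalR (f q).1 ρ + τ * evalR (f q).2.1 ρ + τ ^ 2 * evalR (f q).2.2 ρ := by
  have key : ∀ q ∈ F, ∃ d : List ℝ × List ℝ × List ℝ,
      PMem S d.1 (t3split Wn Wd (rowEntry2 (HRTMAB2.rows2 S A ℓ e D Wn Wd a0 a1 b0 b1 nF) nF q.1 q.2)).1 ∧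
      PMem S d.2.1 (t3split Wn Wd (rowEntry2 (HRTMAB2.rows2 S A ℓ e D Wn Wd a0 a1 b0 b1 nF) nF q.1 q.2)).2.1 ∧
      PMem S (d.2.2.map fun c => |c| * τ ^ 2)
        (t3split Wn Wd (rowEntry2 (HRTMAB2.rows2 S A ℓ e D Wn Wd a0 a1 b0 b1 nF) nF q.1 q.2)).2.2 ∧
      regAB ((a0 : ℝ) + (a1 : ℝ) * τ) ((b0 : ℝ) + (b1 : ℝ) * τ) ((A : ℝ) + ρ) ℓ q.1 q.2 =
        evalR d.1 ρ + τ * evalR d.2.1 ρ + τ ^ 2 * evalR d.2.2 ρ := by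
    intro q hq
    obtain ⟨as, hT, hev⟩ := HRTMAB2.tmem_rows2 hS hWd hD hpiv a0 a1 b0 b1 (hF q hq) q.2 ρ hρ
    obtain ⟨c0s, c1s, h0, h1, hrest⟩ := HRTMAB2.tpmem_split hT
    obtain ⟨c2s, h2, hev2⟩ := hrest τ hτ
    have hb := HRTMAB2.pmem_t3bound (S := S) hWd hτ h2
    exact ⟨(c0s, c1s, c2s), h0, h1, hb, (hev τ hτ).trans (hev2 ρ)⟩
  classical
  refine ⟨fun q => if hq : q ∈ F then Classical.choose (key q hq) else ([], [], []), fun q hq => ?_⟩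
  simp only [dif_pos hq]
  exact Classical.choose_spec (key q hq)

/-- `(½)^{(ε₀+y)−(σ₀+x)} = (½)^{ε₀−σ₀} · e^{ln 2 (x − y)}` in the form needed below. [folklore] -/
theorem half_rpow_centre (σ0 ε0 a b : ℝ) :
    (1 / 2 : ℝ) ^ (b - a) = (1 / 2 : ℝ) ^ (ε0 - σ0) * Real.exp (Real.log 2 * ((a - σ0) - (b - ε0))) := by
  rw [HeadScalars2.half_rpow_eq_exp, HeadScalars2.half_rpow_eq_exp, ← Real.exp_add]; congr 1; ring

/-- `(½)^{−2(σ₀+x)} = (½)^{−2σ₀} · e^{2 ln 2 · x}`. [folklore] -/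
theorem half_rpow_lin (σ0 a : ℝ) :
    (1 / 2 : ℝ) ^ (-(2 * a)) = (1 / 2 : ℝ) ^ (-(2 * σ0)) * Real.exp (2 * Real.log 2 * (a - σ0)) := by
  rw [HeadScalars2.half_rpow_eq_exp, HeadScalars2.half_rpow_eq_exp, ← Real.exp_add]; congr 1; ring

/-- The head weight `(λ_ℓ 2ⁿ)⁻¹` as `(½)ⁿ / λ_ℓ`. [folklore] -/
theorem weight_eq (ℓ n : ℕ) : (((1 / (legendreLamQ ℓ * 2 ^ n) : ℚ)) : ℝ) = (1 / 2 : ℝ) ^ n / legendreLam ℓ := by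
  have hlam : legendreLam ℓ ≠ 0 := (legendreLam_pos ℓ).ne'
  push_cast
  rw [PointKernel.cast_legendreLamQ]
  field_simp
  rw [← mul_pow]; norm_num

/-- **TABLE THEOREM, odd head cell over a wide box, MERGED-2 test** (first order in `(δσ, δε)` jointly in the literals, the `τ`-triple
tables and the three scalars; absolute second-order remainder). Hypotheses: the cell's three `τ`-triple tables are `HRTMAB2.rows2` for
the `(a, b)` families `(−t/2, t/2)`, `(t/2, t/2)`, `(−t/2, −t/2)` with `t = t₀ + τ`, `|τ| ≤ Wt ≤ Wn/Wd`; the CENTRE scalars and their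
`ln 2`-multiples lie in the `Scal2` intervals; `2·max(Wσ,Wε)·ln 2 ≤ U ≤ 1`; every part passes `oddPartOK2`; `oddHeadFinalOK2` passes.
Conclusion: literally that of `oddHead_nonneg_of_partsΔM`. [cite: KosPolandSimmonsduffin2014, §3.3 eq. (3.16)] -/
theorem oddHead_nonneg_of_parts2 (c : Fin 5 → ℕ × ℕ → ℚ) {L : List (ℕ × ℕ)} (ψ : ℕ × ℕ → ℚ) {Lψ : List (ℕ × ℕ)}
    {κ₀ : ℚ} {C : EvenCellTM} (hF : C.F.Nodup) (hFj : ∀ q ∈ C.F, q.2 ≤ C.ℓ + q.1) (hℓlo : (C.ℓ : ℚ) ≤ C.lo)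
    {σlo σhi εlo εhi : ℚ} {R : OddHeadRowsΔ} (hR : R.ValidΔ c L ψ Lψ σlo σhi εlo εhi)
    {Wn : ℤ} {Wd : ℕ} (hWd : 0 < Wd) (hW : ((R.Wt : ℚ) : ℝ) ≤ (Wn : ℝ) / Wd)
    {TS TP TM : List (List HRTMAB2.TPoly)}
    (hTS : TS = HRTMAB2.rows2 R.S C.ctr C.ℓ C.e C.D Wn Wd (-(R.t0 / 2)) (-1 / 2) (R.t0 / 2) (1 / 2) C.nF)
    (hTP : TP = HRTMAB2.rows2 R.S C.ctr C.ℓ C.e C.D Wn Wd (R.t0 / 2) (1 / 2) (R.t0 / 2) (1 / 2) C.nF)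
    (hTM : TM = HRTMAB2.rows2 R.S C.ctr C.ℓ C.e C.D Wn Wd (-(R.t0 / 2)) (-1 / 2) (-(R.t0 / 2)) (-1 / 2) C.nF)
    {sc : Scal2}
    (hK : MI.mem R.S ((1 / 2 : ℝ) ^ ((R.ε0 : ℝ) - R.σ0)) sc.K)
    (hdK : MI.mem R.S (Real.log 2 * (1 / 2 : ℝ) ^ ((R.ε0 : ℝ) - R.σ0)) sc.dK)
    (hC0 : MI.mem R.S ((1 / 2 : ℝ) ^ (-(2 * (R.σ0 : ℝ))) * ((κ₀⁻¹ / 2 : ℚ) : ℝ)) sc.C0)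
    (hdC0 : MI.mem R.S (2 * Real.log 2 * ((1 / 2 : ℝ) ^ (-(2 * (R.σ0 : ℝ))) * ((κ₀⁻¹ / 2 : ℚ) : ℝ))) sc.dC0x)
    (hCt : MI.mem R.S ((1 / 2 : ℝ) ^ (-(2 * (R.ε0 : ℝ))) * ((-(κ₀⁻¹ / 2) : ℚ) : ℝ)) sc.Ct)
    (hdCt : MI.mem R.S (2 * Real.log 2 * ((1 / 2 : ℝ) ^ (-(2 * (R.ε0 : ℝ))) * ((-(κ₀⁻¹ / 2) : ℚ) : ℝ))) sc.dCty)
    (hU : 2 * max (R.Wσ : ℝ) R.Wε * Real.log 2 ≤ sc.U) (hU1 : (sc.U : ℝ) ≤ 1)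
    {dP : ℕ} {ps : List HeadPart2} (hparts : ∀ p ∈ ps, oddPartOK2 R C TS TP TM sc Wn Wd p = true)
    (h : oddHeadFinalOK2 R dP C ps = true) :
    ∀ p ∈ Icc (σlo : ℝ) σhi ×ˢ Icc (εlo : ℝ) εhi, ∀ Δ : ℝ, (C.lo : ℝ) ≤ Δ → Δ ≤ C.hi → unitarityBound3D C.ℓ < Δ →
      0 ≤ ∑ q ∈ C.F.toFinset, oddConeHeadValue
        (taylorCrossing (1 / 2) (1 / 2) L.toFinset (fun k ab => (c k ab : ℝ)))
        (∑ ab ∈ Lψ.toFinset, (ψ ab : ℝ) • taylorCoeffAt (1 / 2) (1 / 2) ab) κ₀ p.1 p.2 Δ C.ℓ q := by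
  subst hTS hTP hTM
  intro p hp Δ hlo hhi hbΔ
  obtain ⟨hS, hWσ, hWε, hV⟩ := hR
  obtain ⟨hδσ, hδε, hrows⟩ := hV p hp
  simp only [oddHeadFinalOK2, oddHeadStructOK2, Bool.and_eq_true, decide_eq_true_eq, List.all_eq_true] at h
  obtain ⟨⟨⟨⟨⟨hD, hpiv⟩, hJ'⟩, hch⟩, hcnt⟩, hpos⟩ := h
  have hJ : ∀ q ∈ C.F, q.2 < R.J := fun q hq => hJ' q hq
  -- the local variable
  set ρ : ℝ := Δ - (C.ctr : ℝ) with hρdef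
  have hΔ : Δ = (C.ctr : ℝ) + ρ := by rw [hρdef]; ring
  have hlo' : ((C.lo : ℚ) : ℝ) = (C.ctr : ℝ) - ((C.hw : ℚ) : ℝ) := by rw [EvenCellTM.lo]; push_cast; ring
  have hhi' : ((C.hi : ℚ) : ℝ) = (C.ctr : ℝ) + ((C.hw : ℚ) : ℝ) := by rw [EvenCellTM.hi]; push_cast; ring
  have hρ1 : ((-C.hw : ℚ) : ℝ) ≤ ρ := by push_cast; linarith
  have hρ2 : ρ ≤ ((C.hw : ℚ) : ℝ) := by linarith
  have hρabs : |ρ| ≤ ((((1 : ℚ) / 2 ^ C.e : ℚ)) : ℝ) := by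
    have : ((C.hw : ℚ) : ℝ) = (((1 : ℚ) / 2 ^ C.e : ℚ) : ℝ) := by rw [EvenCellTM.hw]
    rw [abs_le, ← this]; exact ⟨by linarith, hρ2⟩
  -- the τ offset of this box point
  have hτ : |(p.1 - R.σ0) - (p.2 - R.ε0)| ≤ (Wn : ℝ) / Wd := by
    refine le_trans ?_ hW
    unfold OddHeadRowsΔ.Wt; push_cast
    rw [abs_le] at hδσ hδε ⊢; constructor <;> linarith [hδσ.1, hδσ.2, hδε.1, hδε.2]
  -- table data
  obtain ⟨fS, hfS⟩ := table_data2 hS hWd hD hpiv (-(R.t0 / 2)) (-1 / 2) (R.t0 / 2) (1 / 2) hρabs hτ (F := C.F) C.le_nF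
  obtain ⟨fP, hfP⟩ := table_data2 hS hWd hD hpiv (R.t0 / 2) (1 / 2) (R.t0 / 2) (1 / 2) hρabs hτ (F := C.F) C.le_nF
  obtain ⟨fM, hfM⟩ := table_data2 hS hWd hD hpiv (-(R.t0 / 2)) (-1 / 2) (-(R.t0 / 2)) (-1 / 2) hρabs hτ (F := C.F) C.le_nF
  -- literal data (verbatim as in `oddHead_nonneg_of_partsΔ_sound`)
  classical
  let r3 : ℕ → List ℝ × List ℝ × List ℝ := fun j => if hj : j < R.J then Classical.choose (hrows j hj).1 else ([], [], [])
  let r4 : ℕ → List ℝ × List ℝ × List ℝ := fun j => if hj : j < R.J then Classical.choose (hrows j hj).2.1 else ([], [], [])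
  let r5 : ℕ → List ℝ × List ℝ × List ℝ := fun j =>
    if hj : j < R.J then Classical.choose (hrows j hj).2.2.1 else ([], [], [])
  let r0 : ℕ → List ℝ × List ℝ × List ℝ := fun j =>
    if hj : j < R.J then Classical.choose (hrows j hj).2.2.2.1 else ([], [], [])
  let rt : ℕ → List ℝ × List ℝ × List ℝ := fun j =>
    if hj : j < R.J then Classical.choose (hrows j hj).2.2.2.2 else ([], [], [])
  have s3 : ∀ q ∈ C.F, PMem3 R.S (r3 q.2) (R.lit q.2).1 ∧ ∀ E : ℝ,
      qSum (fun ab => (c 2 ab : ℝ)) L.toFinset ((p.1 + p.2) / 2) (-1) E q.2 = val3 (r3 q.2) E ((p.1 + p.2) / 2 - R.b0) := by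
    intro q hq; have hs := Classical.choose_spec (hrows q.2 (hJ q hq)).1; simp only [r3, dif_pos (hJ q hq)]; exact hs
  have s4 : ∀ q ∈ C.F, PMem3 R.S (r4 q.2) (R.lit q.2).2.1 ∧ ∀ E : ℝ,
      qSum (fun ab => (c 3 ab : ℝ)) L.toFinset p.1 (-1) E q.2 = val3 (r4 q.2) E (p.1 - R.σ0) := by
    intro q hq; have hs := Classical.choose_spec (hrows q.2 (hJ q hq)).2.1; simp only [r4, dif_pos (hJ q hq)]; exact hs
  have s5 : ∀ q ∈ C.F, PMem3 R.S (r5 q.2) (R.lit q.2).2.2.1 ∧ ∀ E : ℝ,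
      qSum (fun ab => (c 4 ab : ℝ)) L.toFinset p.1 1 E q.2 = val3 (r5 q.2) E (p.1 - R.σ0) := by
    intro q hq; have hs := Classical.choose_spec (hrows q.2 (hJ q hq)).2.2.1; simp only [r5, dif_pos (hJ q hq)]; exact hs
  have s0 : ∀ q ∈ C.F, PMem3 R.S (r0 q.2) (R.lit q.2).2.2.2.1 ∧ ∀ E : ℝ,
      qSum (fun ab => (ψ ab : ℝ)) Lψ.toFinset 0 0 E q.2 = val3 (r0 q.2) E 0 := by
    intro q hq; have hs := Classical.choose_spec (hrows q.2 (hJ q hq)).2.2.2.1; simp only [r0, dif_pos (hJ q hq)]; exact hs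
  have st : ∀ q ∈ C.F, PMem3 R.S (rt q.2) (R.lit q.2).2.2.2.2 ∧ ∀ E : ℝ,
      qSum (fun ab => (ψ ab : ℝ)) Lψ.toFinset (p.1 - p.2) 0 E q.2 = val3 (rt q.2) E ((p.1 - p.2) - R.t0) := by
    intro q hq; have hs := Classical.choose_spec (hrows q.2 (hJ q hq)).2.2.2.2; simp only [rt, dif_pos (hJ q hq)]; exact hs
  -- the merged-2 sign test
  have hWs : (R.Wσ : ℝ) ≤ max (R.Wσ : ℝ) R.Wε := le_max_left _ _
  have hWe : (R.Wε : ℝ) ≤ max (R.Wσ : ℝ) R.Wε := le_max_right _ _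
  have hmain := final2_sound hS (C := C) (sc := sc) (Wn := Wn) (Wd := Wd)
    (fun q hq => (s3 q hq).1) (fun q hq => (s4 q hq).1) (fun q hq => (s5 q hq).1) (fun q hq => (s0 q hq).1)
    (fun q hq => (st q hq).1) hδσ hδε
    (eS0 := fun q => (fS q).1) (eS1 := fun q => (fS q).2.1) (eS2 := fun q => (fS q).2.2)
    (eP0 := fun q => (fP q).1) (eP1 := fun q => (fP q).2.1) (eP2 := fun q => (fP q).2.2)
    (eM0 := fun q => (fM q).1) (eM1 := fun q => (fM q).2.1) (eM2 := fun q => (fM q).2.2)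
    (fun q hq => (hfS q hq).1) (fun q hq => (hfS q hq).2.1) (fun q hq => (hfS q hq).2.2.1)
    (fun q hq => (hfP q hq).1) (fun q hq => (hfP q hq).2.1) (fun q hq => (hfP q hq).2.2.1)
    (fun q hq => (hfM q hq).1) (fun q hq => (hfM q hq).2.1) (fun q hq => (hfM q hq).2.2.1)
    hK hdK hC0 hdC0 hCt hdCt hWs hWe hU hU1 hparts hch hcnt hpos hρ1 hρ2
  -- identification of the head-term values with the regularised brackets
  have eaN : (-(p.1 - p.2) / 2 : ℝ) = ((-(R.t0 / 2) : ℚ) : ℝ) + ((-1 / 2 : ℚ) : ℝ) * ((p.1 - R.σ0) - (p.2 - R.ε0)) := by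
    unfold OddHeadRowsΔ.t0; push_cast; ring
  have eaP : ((p.1 - p.2) / 2 : ℝ) = ((R.t0 / 2 : ℚ) : ℝ) + ((1 / 2 : ℚ) : ℝ) * ((p.1 - R.σ0) - (p.2 - R.ε0)) := by
    unfold OddHeadRowsΔ.t0; push_cast; ring
  have eK := half_rpow_centre (R.σ0 : ℝ) (R.ε0 : ℝ) p.1 p.2
  have eMσ := half_rpow_lin (R.σ0 : ℝ) p.1
  have eMε := half_rpow_lin (R.ε0 : ℝ) p.2
  have eE : ∀ q : ℕ × ℕ, ((((q.1 : ℚ) + C.ctr : ℚ)) : ℝ) + ρ = (C.ctr : ℝ) + ρ + (q.1 : ℝ) := fun q => by push_cast; ring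
  have hterm : ∀ q ∈ C.F, (1 / 2 : ℝ) ^ q.1 *
      oddBracketReg L.toFinset (fun k ab => (c k ab : ℝ)) Lψ.toFinset (fun ab => (ψ ab : ℝ)) (κ₀ : ℝ) p.1 p.2
        ((C.ctr : ℝ) + ρ) C.ℓ q =
      termVal2 C.ℓ C.ctr q (r3 q.2) (r4 q.2) (r5 q.2) (r0 q.2) (rt q.2) (fS q).1 (fS q).2.1 (fS q).2.2
        (fP q).1 (fP q).2.1 (fP q).2.2 (fM q).1 (fM q).2.1 (fM q).2.2
        ((1 / 2 : ℝ) ^ ((R.ε0 : ℝ) - R.σ0)) ((1 / 2 : ℝ) ^ (-(2 * (R.σ0 : ℝ))) * ((κ₀⁻¹ / 2 : ℚ) : ℝ))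
        ((1 / 2 : ℝ) ^ (-(2 * (R.ε0 : ℝ))) * ((-(κ₀⁻¹ / 2) : ℚ) : ℝ)) (p.1 - R.σ0) (p.2 - R.ε0) ρ := by
    intro q hq
    simp only [oddBracketReg]
    rw [eaN, eaP, (hfS q hq).2.2.2, (hfP q hq).2.2.2, (hfM q hq).2.2.2, (s3 q hq).2, (s4 q hq).2, (s5 q hq).2,
      (s0 q hq).2, (st q hq).2, eK, eMσ, eMε]
    simp only [termVal2, val3, evalR_shiftR, eE q]
    rw [weight_eq]
    unfold OddHeadRowsΔ.b0 OddHeadRowsΔ.t0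
    push_cast
    ring
  have hreg : 0 < (C.F.map fun q => (1 / 2 : ℝ) ^ q.1 *
      oddBracketReg L.toFinset (fun k ab => (c k ab : ℝ)) Lψ.toFinset (fun ab => (ψ ab : ℝ)) (κ₀ : ℝ) p.1 p.2
        ((C.ctr : ℝ) + ρ) C.ℓ q).sum := by
    rw [List.map_congr_left hterm]; exact hmain
  -- remove the regularisation factor (verbatim as in `oddHead_nonneg_of_partsΔ_sound`)
  have hfac : (C.F.map fun q => (1 / 2 : ℝ) ^ q.1 *
      oddBracketReg L.toFinset (fun k ab => (c k ab : ℝ)) Lψ.toFinset (fun ab => (ψ ab : ℝ)) (κ₀ : ℝ) p.1 p.2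
        ((C.ctr : ℝ) + ρ) C.ℓ q).sum =
      (Δ - unitarityBound3D C.ℓ) * (C.F.map fun q => (1 / 2 : ℝ) ^ q.1 *
        oddConeHeadBracket L.toFinset (fun k ab => (c k ab : ℝ)) Lψ.toFinset (fun ab => (ψ ab : ℝ)) (κ₀ : ℝ) p.1 p.2
          Δ C.ℓ q).sum := by
    rw [← List.sum_map_mul_left]
    congr 1
    refine List.map_congr_left fun q _ => ?_
    rw [← hΔ, oddBracketReg_eq _ _ _ _ _ _ _ hbΔ]; ring
  rw [hfac] at hreg
  have hx : 0 < Δ - unitarityBound3D C.ℓ := sub_pos.mpr hbΔ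
  have h' := (pos_iff_pos_of_mul_pos hreg).mp hx
  have hFj' : ∀ q ∈ C.F.toFinset, (q.2 : ℝ) ≤ Δ + (q.1 : ℝ) := by
    intro q hq
    have h1 : q.2 ≤ C.ℓ + q.1 := hFj q (List.mem_toFinset.mp hq)
    have : (q.2 : ℝ) ≤ (C.ℓ : ℝ) + (q.1 : ℝ) := by exact_mod_cast h1
    have hℓΔ : (C.ℓ : ℝ) ≤ Δ := by
      have : ((C.ℓ : ℚ) : ℝ) ≤ ((C.lo : ℚ) : ℝ) := by exact_mod_cast hℓlo
      push_cast at this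
      linarith
    linarith
  rw [sum_oddConeHeadValue_half_nonneg_iff _ _ _ _ _ _ _ _ _ _ hFj', List.sum_toFinset _ hF]
  have h'' := h'.le
  simpa [Real.rpow_natCast] using h''

end HeadParts2

end Summit.CriticalPhenomena.Ising3D
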